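import Summits.QuantumFields.BalabanUV.T4Continuum.Support.RegularBackgroundTower

/-!
# T⁴ programme, spine node NE2 (U1a) — row B5, SHARP THRESHOLD: the covariant-Laplacian summand's `PerturbationLaws` with a relative
# bound `κ` that depends on the REGULARITY CLASS ONLY (size `α`, lattice-Lipschitz `β`), NOT on node NE3's rate constant

NE2 formalisation swarm, leaf prover 03, companion of `Support/RegularBackgroundTower`.  Written after the cross-read of row B7 PART 2
(`Spine/NE2BalabanLayer`, XREAD-p208485 INFO-1): there the displayed small-field threshold `κ_B < 1` contains `kappaCol o d a α (max β βNE3) …`,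
`βNE3 = 2·card o·C`, i.e. it asks NE3's RATE CONSTANT `C` to be small.  That dependence is an ARTIFACT of the interface: tier A's
`LipschitzBackground` carries ONE constant for both the lattice-Lipschitz bound and the two-level consistency, while the (H-bd) half of
`PerturbationLaws` needs only the Lipschitz half (discrete Leibniz) and the consistency enters (H-cons) only.  This file re-derives the laws with
the two constants SPLIT, from the tier-A component lemmas BY NAME (`FirstOrderBackgroundModel.opNorm_firstOrder_mul_calG_le /
opNorm_calG_mul_firstOrder_le / opNorm_consistency_le`, `FirstOrderAdjointModel.opNorm_adjoint_consistency_le`,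
`PerturbationAlgebra.perturbationLaws_zerothOrder`, `KroneckerUnits.perturbationLaws_kronUnit / perturbationLaws_finsetSum`,
`ColourCovariantLaplacian.covPertC_eq`) — no tier-A file is modified:
 * §1 scalar layer: **`perturbationLaws_firstOrder_split`** (`κ = d(α + β_lip)Cst`, `e₂ = C2model(α, β_cons)·L^{−k}`) and
   **`perturbationLaws_firstOrderAdjoint_split`** (`κ = d(α + β_lip)Cst`, `e₂ = C2adjSplit(α, β_lip, β_cons)·L^{−k}`);
 * §2 colour layer: **`perturbationLaws_colourCovariantLaplacian_split`** — `κ = kappaCol o d a α β_lip α′` (NO consistency constant),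
   `C₂ = C2colSplit o d L a α β_lip β_cons β′`;
 * §3 row B5's END re-derived: **`perturbationLaws_covariantLaplacian_of_regular_sharp`** from `(hreg : RegularTransporters R α β)` and
   `(hNE3 : LocalRate (bgReadings (regClass R)) C L⁻¹)` with **`κ = kappaCol o d a α β (d(α² + 2β))`** — a function of `(card o, d, a, α, β)`
   ALONE; NE3's constant `C` appears only in `C₂`.  Hence the physical coupling `t = 1` is reached under the DISPLAYED threshold
   `kappaCol o d a α β (d(α² + 2β)) < 1` on the REGULARITY CLASS — **`covariantLaplacian_rate_of_regular_sharp`** — which is what [B9]'s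
   «α₀ sufficiently small» (p.396) is about; NE3 then only has to deliver SOME rate constant `C`, not a small one.  The assembly (row B7) may
   swap `perturbationLaws_covariantLaplacian_of_regular` for the sharp version by name; `kappaB` then loses its `βNE3`.

HONEST FRAMING (T4-DAG p. 1).  Re-packaging of tier-A theorems with split constants; MODEL LEVEL (transporters as data, global small field);
ONLY the covariant-Laplacian summand; binders `hreg`/`hNE3` displayed, NE3 consumed BY NAME (OPEN); NOT [B9] (3.23)–(3.26) as printed; NE2 NOT
proved; NOT infinite volume, NOT a mass gap, NOT Clay, NOT summit progress; spine 0/9 unchanged.  HONEST DEPENDENCY: continuum YM on T⁴ ⇐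
BetaPertH ∧ nine spine estimates (0/9 proved); BetaPertH ⇐ (D1) ∧ (D4) ∧ CAP+tail; G-an2-4 gates asym, D1 and NE2/3/4.  ABSOLUTE RULE kept;
no `sorry`.
-/

noncomputable section

open scoped BigOperators ComplexConjugate Matrix Matrix.Norms.L2Operator Kronecker

namespace Summit.QuantumFields.BalabanUV.T4Continuum.RegularBackgroundTowerSharp

open Literature.MathematicalPhysics.QuantumFieldTheory.Balaban1983to89.B5Prop11Plancherel
open Literature.MathematicalPhysics.QuantumFieldTheory.Balaban1983to89.B5G183RateUnitTower (lev lev_neZero)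
open Literature.MathematicalPhysics.QuantumFieldTheory.Balaban1983to89.T4EtaRateMin (LocalRate)
open Summit.QuantumFields.BalabanUV.T4Continuum
open Summit.QuantumFields.BalabanUV.T4Continuum.CovariantAveragingTower (TowerLimitRate)
open Summit.QuantumFields.BalabanUV.T4Continuum.BalabanAveragedTowerUnit (idx Qlev calGlev one_le_lev' cast_lev')
open Summit.QuantumFields.BalabanUV.T4Continuum.BackgroundResolventTower
open Summit.QuantumFields.BalabanUV.T4Continuum.KingPairingPlantedLaw
open Summit.QuantumFields.BalabanUV.T4Continuum.BlockPairingGeometry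
open Summit.QuantumFields.BalabanUV.T4Continuum.NE2PerturbedLayer
open Summit.QuantumFields.BalabanUV.T4Continuum.FirstOrderBackgroundModel
open Summit.QuantumFields.BalabanUV.T4Continuum.PerturbationAlgebra
open Summit.QuantumFields.BalabanUV.T4Continuum.FirstOrderAdjointModel
open Summit.QuantumFields.BalabanUV.T4Continuum.KroneckerLift
open Summit.QuantumFields.BalabanUV.T4Continuum.KroneckerUnits
open Summit.QuantumFields.BalabanUV.T4Continuum.ColourCovariantLaplacian
open Summit.QuantumFields.BalabanUV.T4Continuum.NE2FromNE3 (bgReadings consistent_of_localRate_lev)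
open Summit.QuantumFields.BalabanUV.T4Continuum.RegularBackgroundTower

variable {d : ℕ} (L : ℕ) [NeZero L] (M : Fin d → ℕ) [hM : ∀ μ, NeZero (M μ)] (a : ℝ) (ha : 0 < a)

/-! ## §1 The scalar first-order laws with split Lipschitz / consistency constants -/

/-- the (H-cons) constant of the adjoint family with split constants: `d·(Cst·β_cons·Cst + 2dCst(L + 1)(α + β_lip)Cst)`. [folklore] -/
def C2adjSplit (d L : ℕ) (a α βl βc : ℝ) : ℝ := d * (Cst d a * βc * Cst d a + 2 * d * Cst d a * ((L : ℝ) + 1) * ((α + βl) * Cst d a))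

/-- **`PerturbationLaws` FOR THE FIRST-ORDER MODEL, SPLIT CONSTANTS** (`d ≥ 1`): size `α`, lattice-Lipschitz `β_lip/L^k`, two-level consistency
`β_cons/L^k` give `κ = d(α + β_lip)Cst` and `e₂ k = C2model d L a α β_cons·L^{−k}` — the consistency constant does NOT enter `κ`.
[cite: Balaban1984PropagatorsI, Prop. 1.1 (1.89) p.33; King1986, (2.10) p.653] [folklore] -/
theorem perturbationLaws_firstOrder_split (hd : 1 ≤ d) {V : (k : ℕ) → Fin d → (idx L M k → ℂ)} {α βl βc : ℝ} (hα : 0 ≤ α)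
    (hβl : 0 ≤ βl) (hβc : 0 ≤ βc) (hb : ∀ k μ (i : idx L M k), ‖V k μ i‖ ≤ α)
    (hl : ∀ k μ ν (i : idx L M k), ‖V k μ (tau (fine (lev L k) M) ν i) - V k μ i‖ ≤ βl / (lev L k : ℕ))
    (hc : ∀ k μ (i : idx L M (k + 1)), ‖V (k + 1) μ i - V k μ (parT (lev L k) L M i)‖ ≤ βc / (lev L k : ℕ)) :
    PerturbationLaws (calDalev L M a ha) (Pmodel L M V) (JpcT L M) (d * (α + βl) * Cst d a)
      (fun k => C2model d L a α βc * ((L : ℝ)⁻¹) ^ k) where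
  opNorm_P_mul_inv_le := fun k => by
    rw [calDalev_inv]
    have h := opNorm_firstOrder_mul_calG_le (lev L k) (one_le_lev' L k) M a ha hα (hb k)
    refine h.trans ?_
    exact mul_le_mul_of_nonneg_right (mul_le_mul_of_nonneg_left (le_add_of_nonneg_right hβl) (Nat.cast_nonneg d))
      (Cst_nonneg d a)
  opNorm_inv_mul_P_le := fun k => by
    rw [calDalev_inv]
    exact opNorm_calG_mul_firstOrder_le (lev L k) (one_le_lev' L k) M a ha hα hβl (hb k) (fun μ i => hl k μ μ i)
  consistent_le := fun k => by
    have hL1 : 1 ≤ L := Nat.pos_of_ne_zero (NeZero.ne L)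
    have hLpos : (0 : ℝ) < L := by exact_mod_cast hL1
    have hlev : (0 : ℝ) < (lev L k : ℕ) := by exact_mod_cast one_le_lev' L k
    rw [calDalev_inv, calDalev_inv]
    have h := opNorm_consistency_le (lev L k) L M a ha hd (one_le_lev' L k) (one_le_lev' L (k + 1)) hα
      (div_nonneg hβc hlev.le) (hb k) (hc k)
    refine h.trans (le_of_eq ?_)
    rw [C2model, cast_lev', inv_pow]
    have hLk : (0 : ℝ) < (L : ℝ) ^ k := pow_pos hLpos k
    field_simp

/-- **`PerturbationLaws` FOR THE ADJOINT FAMILY, SPLIT CONSTANTS** (`d ≥ 1`): `κ = d(α + β_lip)Cst`, `e₂ k = C2adjSplit·L^{−k}`.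
[cite: Balaban1984PropagatorsI, Prop. 1.1 (1.89) p.33; King1986, (2.10) p.653] [folklore] -/
theorem perturbationLaws_firstOrderAdjoint_split (hd : 1 ≤ d) {V : (k : ℕ) → Fin d → (idx L M k → ℂ)} {α βl βc : ℝ} (hα : 0 ≤ α)
    (hβl : 0 ≤ βl) (hβc : 0 ≤ βc) (hb : ∀ k μ (i : idx L M k), ‖V k μ i‖ ≤ α)
    (hl : ∀ k μ ν (i : idx L M k), ‖V k μ (tau (fine (lev L k) M) ν i) - V k μ i‖ ≤ βl / (lev L k : ℕ))
    (hc : ∀ k μ (i : idx L M (k + 1)), ‖V (k + 1) μ i - V k μ (parT (lev L k) L M i)‖ ≤ βc / (lev L k : ℕ)) :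
    PerturbationLaws (calDalev L M a ha) (fun k => (Pmodel L M V k)ᴴ) (JpcT L M) (d * (α + βl) * Cst d a)
      (fun k => C2adjSplit d L a α βl βc * ((L : ℝ)⁻¹) ^ k) where
  opNorm_P_mul_inv_le := fun k => by
    have e : (Pmodel L M V k)ᴴ * (calDalev L M a ha k)⁻¹ = ((calDalev L M a ha k)⁻¹ * Pmodel L M V k)ᴴ := by
      rw [Matrix.conjTranspose_mul, conjTranspose_inv_calDalev]
    rw [e, Matrix.l2_opNorm_conjTranspose]
    exact (perturbationLaws_firstOrder_split L M a ha hd hα hβl hβc hb hl hc).opNorm_inv_mul_P_le k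
  opNorm_inv_mul_P_le := fun k => by
    have e : (calDalev L M a ha k)⁻¹ * (Pmodel L M V k)ᴴ = (Pmodel L M V k * (calDalev L M a ha k)⁻¹)ᴴ := by
      rw [Matrix.conjTranspose_mul, conjTranspose_inv_calDalev]
    rw [e, Matrix.l2_opNorm_conjTranspose]
    exact (perturbationLaws_firstOrder_split L M a ha hd hα hβl hβc hb hl hc).opNorm_P_mul_inv_le k
  consistent_le := fun k => by
    have hL1 : 1 ≤ L := Nat.pos_of_ne_zero (NeZero.ne L)
    have hLpos : (0 : ℝ) < L := by exact_mod_cast hL1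
    have hlev : (0 : ℝ) < (lev L k : ℕ) := by exact_mod_cast one_le_lev' L k
    change ‖(calDalev L M a ha (k + 1))⁻¹ * ((Pmodel L M V (k + 1))ᴴ * JpcT L M k - JpcT L M k * (Pmodel L M V k)ᴴ)
        * (calDalev L M a ha k)⁻¹‖ ≤ _
    rw [calDalev_inv, calDalev_inv]
    have h := opNorm_adjoint_consistency_le (lev L k) L M a ha hd (one_le_lev' L k) (one_le_lev' L (k + 1)) hα hβl
      (div_nonneg hβc hlev.le) (hb k) (fun μ i => hl k μ μ i) (hc k)
    refine h.trans (le_of_eq ?_)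
    rw [C2adjSplit, cast_lev', inv_pow]
    have hLk : (0 : ℝ) < (L : ℝ) ^ k := pow_pos hLpos k
    field_simp

/-! ## §2 The colour covariant Laplacian with split constants -/

variable {o : Type*} [Fintype o] [DecidableEq o]

/-- the colour consistency constant with split constants `(card o)²·(C2model(α, β_cons) + C2adjSplit(α, β_lip, β_cons) + Cst²β′)`. [folklore] -/
def C2colSplit (o : Type*) [Fintype o] (d L : ℕ) (a α βl βc β' : ℝ) : ℝ :=
  (Fintype.card o : ℝ) ^ 2 * (C2model d L a α βc + C2adjSplit d L a α βl βc + Cst d a * β' * Cst d a)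

/-- **`PerturbationLaws` FOR THE NON-ABELIAN COVARIANT LAPLACIAN, SPLIT CONSTANTS** (`d ≥ 1`): matrix-level size `α`, lattice-Lipschitz `β_lip`
and two-level consistency `β_cons` of the connection `−w`, plus a `BoundedBackgroundM (α′, β′)` zeroth-order field, give the target shape for
`covPertC L M R` with `κ = kappaCol o d a α β_lip α′` — INDEPENDENT of `β_cons` — and `C₂ = C2colSplit`.  Proof = the owner's matrix-unit
reduction (`covPertC_eq`, `perturbationLaws_kronUnit`, `perturbationLaws_finsetSum`) over the split scalar laws. [folklore] -/
theorem perturbationLaws_colourCovariantLaplacian_split (hd : 1 ≤ d) {R : (k : ℕ) → Fin d → (idx L M k → Matrix o o ℂ)}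
    {α βl βc α' β' : ℝ} (hα : 0 ≤ α) (hβl : 0 ≤ βl) (hβc : 0 ≤ βc)
    (hb : ∀ k ν (i : idx L M k), ‖negConnM (fine (lev L k) M) ((lev L k : ℕ) : ℂ) (R k) ν i‖ ≤ α)
    (hl : ∀ k ν μ (i : idx L M k), ‖negConnM (fine (lev L k) M) ((lev L k : ℕ) : ℂ) (R k) ν (tau (fine (lev L k) M) μ i)
      - negConnM (fine (lev L k) M) ((lev L k : ℕ) : ℂ) (R k) ν i‖ ≤ βl / (lev L k : ℕ))
    (hc : ∀ k ν (i : idx L M (k + 1)), ‖negConnM (fine (lev L (k + 1)) M) ((lev L (k + 1) : ℕ) : ℂ) (R (k + 1)) ν i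
      - negConnM (fine (lev L k) M) ((lev L k : ℕ) : ℂ) (R k) ν (parT (lev L k) L M i)‖ ≤ βc / (lev L k : ℕ))
    (hz : BoundedBackgroundM L M (fun k i => zfieldC (fine (lev L k) M) ((lev L k : ℕ) : ℂ) (R k) i) α' β') :
    PerturbationLaws (fun k => calDalev L M a ha k ⊗ₖ (1 : Matrix o o ℂ)) (covPertC L M R)
      (fun k => JpcT L M k ⊗ₖ (1 : Matrix o o ℂ)) (kappaCol o d a α βl α') (fun k => C2colSplit o d L a α βl βc β' * ((L : ℝ)⁻¹) ^ k) := by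
  -- entrywise hypotheses for the scalar towers `Vab R p`
  have hbp : ∀ (p : o × o) k μ (i : idx L M k), ‖Vab L M R p k μ i‖ ≤ α := fun p k μ i =>
    (norm_entry_le _ p.1 p.2).trans (hb k μ i)
  have hlp : ∀ (p : o × o) k μ ν (i : idx L M k),
      ‖Vab L M R p k μ (tau (fine (lev L k) M) ν i) - Vab L M R p k μ i‖ ≤ βl / (lev L k : ℕ) := fun p k μ ν i => by
    show ‖negConnM (fine (lev L k) M) ((lev L k : ℕ) : ℂ) (R k) μ (tau (fine (lev L k) M) ν i) p.1 p.2
        - negConnM (fine (lev L k) M) ((lev L k : ℕ) : ℂ) (R k) μ i p.1 p.2‖ ≤ βl / (lev L k : ℕ)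
    rw [← Matrix.sub_apply]; exact (norm_entry_le _ p.1 p.2).trans (hl k μ ν i)
  have hcp : ∀ (p : o × o) k μ (i : idx L M (k + 1)),
      ‖Vab L M R p (k + 1) μ i - Vab L M R p k μ (parT (lev L k) L M i)‖ ≤ βc / (lev L k : ℕ) := fun p k μ i => by
    show ‖negConnM (fine (lev L (k + 1)) M) ((lev L (k + 1) : ℕ) : ℂ) (R (k + 1)) μ i p.1 p.2
        - negConnM (fine (lev L k) M) ((lev L k : ℕ) : ℂ) (R k) μ (parT (lev L k) L M i) p.1 p.2‖ ≤ βc / (lev L k : ℕ)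
    rw [← Matrix.sub_apply]; exact (norm_entry_le _ p.1 p.2).trans (hc k μ i)
  have hF : PerturbationLaws (fun k => calDalev L M a ha k ⊗ₖ (1 : Matrix o o ℂ)) (fun k => ∑ p : o × o, pieceF L M R p k)
      (fun k => JpcT L M k ⊗ₖ (1 : Matrix o o ℂ)) (∑ _p : o × o, d * (α + βl) * Cst d a)
      (fun k => ∑ _p : o × o, C2model d L a α βc * ((L : ℝ)⁻¹) ^ k) :=
    perturbationLaws_finsetSum _ fun p _ =>
      perturbationLaws_kronUnit (perturbationLaws_firstOrder_split L M a ha hd hα hβl hβc (hbp p) (hlp p) (hcp p)) p.1 p.2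
  have hA : PerturbationLaws (fun k => calDalev L M a ha k ⊗ₖ (1 : Matrix o o ℂ)) (fun k => ∑ p : o × o, pieceA L M R p k)
      (fun k => JpcT L M k ⊗ₖ (1 : Matrix o o ℂ)) (∑ _p : o × o, d * (α + βl) * Cst d a)
      (fun k => ∑ _p : o × o, C2adjSplit d L a α βl βc * ((L : ℝ)⁻¹) ^ k) :=
    perturbationLaws_finsetSum _ fun p _ =>
      perturbationLaws_kronUnit (perturbationLaws_firstOrderAdjoint_split L M a ha hd hα hβl hβc (hbp p) (hlp p) (hcp p)) p.2 p.1
  have hZ : PerturbationLaws (fun k => calDalev L M a ha k ⊗ₖ (1 : Matrix o o ℂ)) (fun k => ∑ p : o × o, pieceZ L M R p k)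
      (fun k => JpcT L M k ⊗ₖ (1 : Matrix o o ℂ)) (∑ _p : o × o, α' * Cst d a)
      (fun k => ∑ _p : o × o, Cst d a * β' * Cst d a * ((L : ℝ)⁻¹) ^ k) :=
    perturbationLaws_finsetSum _ fun p _ => perturbationLaws_kronUnit (perturbationLaws_zerothOrder L M a ha (boundedBackground_entry L M hz p)) p.1 p.2
  have h := perturbationLaws_add (perturbationLaws_add hF hA) hZ
  have e : covPertC L M R = fun k => (∑ p : o × o, pieceF L M R p k) + (∑ p : o × o, pieceA L M R p k) + ∑ p : o × o, pieceZ L M R p k :=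
    funext fun k => covPertC_eq L M R k
  rw [e]
  refine perturbationLaws_mono h (le_of_eq ?_) fun k => le_of_eq ?_
  · simp only [Finset.sum_const, Finset.card_univ, Fintype.card_prod, kappaCol]; ring
  · simp only [Finset.sum_const, Finset.card_univ, Fintype.card_prod, C2colSplit]; ring

/-! ## §3 Row B5's END with the sharp threshold -/

/-- **THE COVARIANT-LAPLACIAN SUMMAND's `PerturbationLaws` FROM THE REGULARITY CLASS AND NODE NE3, SHARP THRESHOLD** (`d ≥ 1`):
`κ = kappaCol o d a α β (d(α² + 2β))` depends on the regularity class `(α, β)` ONLY; NE3's rate constant `C` (`βNE3 = 2·card o·C`) enters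
`C₂ = C2colSplit o d L a α β βNE3 (d(2α(βNE3 + β) + 2βNE3))` only.  Binders `hreg`, `hNE3` displayed. [folklore] -/
theorem perturbationLaws_covariantLaplacian_of_regular_sharp (hd : 1 ≤ d) {R : (k : ℕ) → Fin d → (idx L M k → Matrix o o ℂ)} {α β : ℝ}
    (hreg : RegularTransporters L M R α β) {C : ℝ} (hC : 0 ≤ C) (hNE3 : LocalRate (bgReadings L M (regClass L M R)) C ((L : ℝ)⁻¹)) :
    PerturbationLaws (fun k => calDalev L M a ha k ⊗ₖ (1 : Matrix o o ℂ)) (covPertC L M R)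
      (fun k => JpcT L M k ⊗ₖ (1 : Matrix o o ℂ)) (kappaCol o d a α β (d * (α ^ 2 + 2 * β)))
      (fun k => C2colSplit o d L a α β (betaNE3 o C) (d * (2 * α * (betaNE3 o C + β) + 2 * betaNE3 o C)) * ((L : ℝ)⁻¹) ^ k) := by
  obtain ⟨hα, hβ⟩ := hreg.nonneg
  have hb3 : 0 ≤ betaNE3 o C := by unfold betaNE3; positivity
  have hw := consistent_of_localRate_lev L M hC hNE3 (Set.mem_insert _ _ : connTower L M R ∈ regClass L M R)
  have hD := consistent_of_localRate_lev L M hC hNE3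
    (Set.mem_insert_of_mem _ (Set.mem_singleton _) : dconnTower L M R ∈ regClass L M R)
  refine perturbationLaws_colourCovariantLaplacian_split L M a ha hd hα hβ hb3 (fun k ν i => ?_) (fun k ν μ i => ?_) (fun k ν i => ?_)
    (boundedBackgroundM_of_regular L M hreg hb3 hb3 hw hD)
  · rw [negConnM_eq_neg, norm_neg]; exact norm_connTower_le hreg k ν i
  · rw [negConnM_eq_neg, negConnM_eq_neg, neg_sub_neg, norm_sub_rev]; exact connTower_lipschitz hreg k ν μ i
  · rw [negConnM_eq_neg, negConnM_eq_neg, neg_sub_neg, norm_sub_rev]; exact hw k ν i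

/-- the η-rate for every coupling `‖t‖κ < 1` with the SHARP `κ` (`L ≥ 2`, `d ≥ 1`). [folklore] -/
theorem towerLimitRate_covariantLaplacian_of_regular_sharp (hL : 2 ≤ L) (hd : 1 ≤ d)
    {R : (k : ℕ) → Fin d → (idx L M k → Matrix o o ℂ)} {α β : ℝ} (hreg : RegularTransporters L M R α β) {C : ℝ} (hC : 0 ≤ C)
    (hNE3 : LocalRate (bgReadings L M (regClass L M R)) C ((L : ℝ)⁻¹)) {t : ℂ}
    (ht : ‖t‖ * kappaCol o d a α β (d * (α ^ 2 + 2 * β)) < 1) :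
    TowerLimitRate (fun k => Qlev L M k ⊗ₖ (1 : Matrix o o ℂ)) ((L : ℝ) ^ d)
      (fun k => (calDalev L M a ha k ⊗ₖ (1 : Matrix o o ℂ) + t • covPertC L M R k)⁻¹)
      (Cpert (kappaCol o d a α β (d * (α ^ 2 + 2 * β))) (2 * d * Cst d a) (CJ d a)
        (C2colSplit o d L a α β (betaNE3 o C) (d * (2 * α * (betaNE3 o C + β) + 2 * betaNE3 o C))) 0 t) ((L : ℝ)⁻¹) := by
  have hL1 : (1 : ℝ) < L := by exact_mod_cast (lt_of_lt_of_le one_lt_two hL : 1 < L)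
  have hr : (0 : ℝ) < (L : ℝ) ^ d := pow_pos (lt_trans zero_lt_one hL1) d
  refine towerLimitRate_perturbed hr (freeTowerLaws_kron o (freeTowerLaws_king L M a ha))
    (perturbationLaws_covariantLaplacian_of_regular_sharp L M a ha hd hreg hC hNE3) (inv_lt_one_of_one_lt₀ hL1)
    (fun k => le_rfl) (fun k => le_rfl) (fun k => le_rfl) (fun k => ?_) ht
  simp only [zero_mul, le_refl]

/-- **THE η-RATE AT THE PHYSICAL COUPLING `t = 1` UNDER A THRESHOLD ON THE REGULARITY CLASS ALONE** (`L ≥ 2`, `d ≥ 1`): if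
`kappaCol o d a α β (d(α² + 2β)) < 1` — a condition on `(card o, d, a, α, β)`, free of NE3's constant — the lifted King-averaged unit-lattice
covariances of `(Δ_a^{(k)} ⊗ 1 + Δ^{R_k} − Δ^1 ⊗ 1)⁻¹` converge with rate `L^{−k}`, CONDITIONAL on `hNE3` (displayed) for the value of `C₂`.
NE2 is NOT proved by this. [folklore] -/
theorem covariantLaplacian_rate_of_regular_sharp (hL : 2 ≤ L) (hd : 1 ≤ d) {R : (k : ℕ) → Fin d → (idx L M k → Matrix o o ℂ)}
    {α β : ℝ} (hreg : RegularTransporters L M R α β) {C : ℝ} (hC : 0 ≤ C)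
    (hNE3 : LocalRate (bgReadings L M (regClass L M R)) C ((L : ℝ)⁻¹)) (hsmall : kappaCol o d a α β (d * (α ^ 2 + 2 * β)) < 1) :
    TowerLimitRate (fun k => Qlev L M k ⊗ₖ (1 : Matrix o o ℂ)) ((L : ℝ) ^ d)
      (fun k => (calDalev L M a ha k ⊗ₖ (1 : Matrix o o ℂ) + covPertC L M R k)⁻¹)
      (Cpert (kappaCol o d a α β (d * (α ^ 2 + 2 * β))) (2 * d * Cst d a) (CJ d a)
        (C2colSplit o d L a α β (betaNE3 o C) (d * (2 * α * (betaNE3 o C + β) + 2 * betaNE3 o C))) 0 1) ((L : ℝ)⁻¹) := by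
  have h := towerLimitRate_covariantLaplacian_of_regular_sharp L M a ha hL hd hreg hC hNE3 (t := 1) (by rwa [norm_one, one_mul])
  simpa only [one_smul] using h

end Summit.QuantumFields.BalabanUV.T4Continuum.RegularBackgroundTowerSharp

end
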